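import Summits.QuantumFields.YangMills.Theorems.UnitScaleTiltProp7ComplementaryProjectorPointwiseDecay
import Summits.QuantumFields.YangMills.Theorems.UnitScaleTiltProp7MassiveColumnPointwiseDecay
import HarnessLib

/-!
# Route `UnitScaleTilt`, crux K1 «MinimiserStabilityRegPr» (stmt-QuantumFields-19200), EX face after S45 — **(L3′b)-VALUE FILE V5b: THE POINTWISE VALUE KERNEL OF PRINT'S
# `P = 1 − R_{Q″}(U₀)` CLOSED DOWN TO THE MEMBER LETTERS** — V5 ✓p762771 `Prop7ComplementaryProjectorPointwiseDecay.norm_equiv_sub_projR_single_le` with its ONE displayed pointwise column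
# letter `hcol` DISCHARGED BY NAME by the chair's V4 ✓p762742 `Prop7MassiveColumnPointwiseDecay.norm_equiv_massiveColumn_apply_le_decay` (two rates `κ₀ = min μ ¼`, `κ₀∕2` ⟹ one rate `κ₀∕2`,
# `C_pt := B₁ + B₂`) — width seat `ym3-torus-px5` gen 12; ★p1 g25 CARD-19200-V3-g25 §4 «V5 = … the VALUE kernel of `P = 1 − R_{Q″}` with `η³e^{−δd}`».

Cell `ym3-torus` (HUMAN RULING D-0037; rung R3 = SU(2) YM₃ on T³ — NOT d = 4, NOT infinite volume, NOT a mass gap, NOT Clay).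
THEOREMS ONLY (0 `def`, 0 `sorry`); `--supports stmt-QuantumFields-19200 --as helper`; count-neutral.

WHAT IS PROVED (ns `Summit.QuantumFields.YangMills.Theorems.Prop7ComplementaryProjectorPointwiseDecayClosed`; letters `hseq hι hT G hAG hGA` of the LOD line VERBATIM).
* §1 `two_rate_le_one_rate` (`B₁e^{−κ₀d} + B₂e^{−(κ₀∕2)d} ≤ (B₁ + B₂)e^{−(κ₀∕2)d}` for `d, B₁ ≥ 0`, `κ₀ ≥ 0`), ★ `hcol_of_massiveColumn_decay` — V4 read as V5's one-rate letter `hcol` with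
  `κ := (min μ ¼)∕2` and `C_pt := B₁ + B₂` (the chair's closed-form `B₁`, `B₂`).
* §2 ★★★ `norm_equiv_sub_projR_single_le_closed` — for every printed-regular member (`RegPr`, `10⁷L³ε₀ ≤ 1`), the LOD letters, the column Agmon window at slope `μ > 0` (`hδ₂`, `hwin₂`:
  routeR-w4's ✓`window_delta`∕`window_win` shape), a Gram slope `0 ≤ μ′ < (min μ ¼)∕2` with B2c's window∕gap rows (`hδ`, `hwin`, `hgap`), `‖ι(Q″·)‖ ≤ C_T‖·‖`, `‖G‖ ≤ C_G` and the coarse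
  coercivity `m_B‖f‖ ≤ ‖G(Tf)‖`:
  `‖((1 − projR Δ_{U₀} Q″)(toL2S(δ_{x′} ⊗ X′)))(x)‖_{W₂} ≤ (c₀∕c₁)·(B₁ + B₂)²·C_N(μ′)·(4(2(1 + 1∕((min μ ¼)∕2 − μ′)))³)²·e^{−μ′·tdist(B x, B x′)}·‖X′‖_F`
  — NO displayed column letter left: print's (3.49) VALUE half with `c₀∕c₁ = η³` at the pin, from `RegPr` + the LOD letters + two windows + coercivity.
HYP-SAT (★★OWNER RULING №42 (1)): as V5 ✓p762771 and V4 ✓p762742 state — every hypothesis is inhabited on the literal T³ families at the true quantifier order (`hseq hι hT` ⟸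
✓`exists_intertwiner_of_regPr`∕✓`inner_adjoint_comp`; `G hAG hGA` ⟸ ✓`exists_massive_inverse`; the windows at `μ`, `μ′` small and `hgap`∕`hcoer`∕`hCTb`∕`hGn` ⟸ routeR-w2's
✓`Prop7ComplementaryProjectorBlockDecayKnit` letters from `RegPr`, K-free at the pin `c₁ = c₀ℓ³`); nothing eventual.
HONEST SCOPE.  Composition BY NAME of V5 and V4; the VALUE kernel of `P` only (no `D P D*` — (3.49) proper needs the GRADIENT key (G1-·)∕(★)); nothing of the ten EX rows, `hT`, `hGF`,
EX `stub_existenceMinimalOrbit` or the crux is proved here; the Yang–Mills mass gap is NOT proved.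

References: T. Bałaban, CMP **99** (1985) 389–434 [Balaban1985BackgroundPropagators] ((3.21)–(3.25) p.394, Thm 3.1 (3.42) p.397, (3.49) p.399); CMP **116** (1988) 1–22
[Balaban1988RG2Cluster] ((2.7) p.13).
-/

set_option autoImplicit false

noncomputable section

open scoped BigOperators Matrix.Norms.L2Operator InnerProductSpace ComplexConjugate Matrix

namespace Summit.QuantumFields.YangMills.Theorems.Prop7ComplementaryProjectorPointwiseDecayClosed

open Literature.MathematicalPhysics.QuantumFieldTheory.Balaban1983to89
open Finset
open T4Continuum BlockAveraging
open BlockAveraging (Idx)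
open B7Prop1Explicit (U1 disp)
open B5Eq118OneStroke (iterBlockOf iterBlock mem_iterBlock card_iterBlock)
open B10Eq27TorusAxialLog (holT transl)
open B7TransferAnalyticMean (meanCLM)
open B4Sect5Torus (TSite)
open B9Eq311L2Pairing (WL2)
open B11Eq103H1Complex (SiteL2K BondL2K projR)
open Summit.QuantumFields.YangMills.Theorems.Prop8Chart (emlIterU)
open Literature.MathematicalPhysics.QuantumFieldTheory.Balaban1983to89.T3ContinuumYM3Torus
open T3SectALandauChart (eta eta_pos bgUnits)
open T3PrintedRegularMinimiser (RegPr)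
open T3PrintedRegularOrbits (sites_eq)
open T3LevelShift (siteShift)
open Summit.QuantumFields.YangMills.Theorems.Prop7SectET3Transport (periodsT3 siteEquiv)
open Summit.QuantumFields.YangMills.Theorems.Prop7SectET3HilbertLetters (W₂ frobEquiv toL2 toL2S DL2 DstarL2 covLapSite)
open Summit.QuantumFields.YangMills.Theorems.Prop7ComplementaryProjectorPointwiseDecay (norm_equiv_sub_projR_single_le)
open Summit.QuantumFields.YangMills.Theorems.Prop7MassiveColumnPointwiseDecay (norm_equiv_massiveColumn_apply_le_decay)

variable (F : T3Family) {n K : ℕ} (h : n ≤ K) {c₀ c₁ : ℝ} [Fact (0 < c₀)] [Fact (0 < c₁)]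
  {ε₀ : ℝ} (hε₀ : 0 < ε₀) (hε7 : 10 ^ 7 * (F.L : ℝ) ^ 3 * ε₀ ≤ 1)
  (U₀ : GaugeField (F.P K) 0 (Matrix.specialUnitaryGroup (Fin 2) ℂ)) (hreg : RegPr F n K ε₀ U₀)
  (Q'' : SiteL2K ℂ 3 (periodsT3 F K) c₀ W₂ →ₗ[ℂ] (Site (F.P K) (K - n) → Matrix (Fin 2) (Fin 2) ℂ))
  (hseq : ∀ lam : Site (F.P K) 0 → Matrix (Fin 2) (Fin 2) ℂ, ∃ ns : (j : ℕ) → Site (F.P K) j → Matrix (Fin 2) (Fin 2) ℂ, ns 0 = lam ∧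
      (∀ (j : ℕ) (y : Site (F.P K) (j + 1)), ns (j + 1) y = ns j (emb y) - meanCLM (Idx (F.P K)) (Matrix (Fin 2) (Fin 2) ℂ) fun i : Idx (F.P K) =>
        ns j (emb y) - ((holT (emlIterU j (bgUnits F K U₀)) (emb y) (stairWord i.2.1 (off i.1)) : (Matrix (Fin 2) (Fin 2) ℂ)ˣ) : Matrix (Fin 2) (Fin 2) ℂ) *
          ns j (transl (emb y) (disp (stairWord i.2.1 (off i.1)))) * (((holT (emlIterU j (bgUnits F K U₀)) (emb y) (stairWord i.2.1 (off i.1)))⁻¹ : (Matrix (Fin 2) (Fin 2) ℂ)ˣ) : Matrix (Fin 2) (Fin 2) ℂ)) ∧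
      ns (K - n) = Q'' (toL2S F K c₀ lam))
  (ι : (Site (F.P K) (K - n) → Matrix (Fin 2) (Fin 2) ℂ) →ₗ[ℂ] SiteL2K ℂ 3 (periodsT3 F n) c₁ W₂)
  (hι : ∀ c, ι c = toL2S F n c₁ (fun z => c (siteShift (sites_eq F n K h) z)))
  (T : SiteL2K ℂ 3 (periodsT3 F n) c₁ W₂ →ₗ[ℂ] SiteL2K ℂ 3 (periodsT3 F K) c₀ W₂)
  (hT : ∀ (l : SiteL2K ℂ 3 (periodsT3 F K) c₀ W₂) (f : SiteL2K ℂ 3 (periodsT3 F n) c₁ W₂), ⟪ι (Q'' l), f⟫_ℂ = ⟪l, T f⟫_ℂ)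
  {a : ℝ} (ha : 0 < a)
  (G : SiteL2K ℂ 3 (periodsT3 F K) c₀ W₂ →ₗ[ℂ] SiteL2K ℂ 3 (periodsT3 F K) c₀ W₂)
  (hAG : ∀ f, covLapSite F n K c₀ U₀ (G f) + (a : ℂ) • T (ι (Q'' (G f))) = f)
  (hGA : ∀ u, G (covLapSite F n K c₀ U₀ u + (a : ℂ) • T (ι (Q'' u))) = u)

/-! ## §1 Two rates to one rate; V4 read as V5's column letter -/

omit [Fact (0 < c₀)] [Fact (0 < c₁)] in
/-- `B₁e^{−κ₀d} + B₂e^{−(κ₀∕2)d} ≤ (B₁ + B₂)·e^{−(κ₀∕2)d}` for `0 ≤ B₁`, `0 ≤ κ₀`, `0 ≤ d`. [folklore] -/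
theorem two_rate_le_one_rate {B₁ B₂ κ₀ d : ℝ} (hB₁ : 0 ≤ B₁) (hκ₀ : 0 ≤ κ₀) (hd : 0 ≤ d) :
    B₁ * Real.exp (-(κ₀ * d)) + B₂ * Real.exp (-(κ₀ / 2 * d)) ≤ (B₁ + B₂) * Real.exp (-(κ₀ / 2 * d)) := by
  have h1 : Real.exp (-(κ₀ * d)) ≤ Real.exp (-(κ₀ / 2 * d)) := Real.exp_le_exp.2 (by nlinarith)
  nlinarith [mul_le_mul_of_nonneg_left h1 hB₁]

include hε₀ hε7 hreg hseq hι hT ha hAG in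
/-- ★ **V4 READ AS V5's ONE-RATE COLUMN LETTER**: at a printed-regular member with the column Agmon window at slope `μ > 0` (`hδ₂`, `hwin₂`), every LOD column obeys
`‖(G(Q″†(δ_y ⊗ Y)))(x)‖_{W₂} ≤ (B₁ + B₂)·e^{−((min μ ¼)∕2)·tdist(B x, y)}·‖Y‖` — the chair's ✓`norm_equiv_massiveColumn_apply_le_decay` + `two_rate_le_one_rate`.
[cite: Balaban1985BackgroundPropagators, Thm 3.1 (3.42) p.397, (3.49) p.399] -/
theorem hcol_of_massiveColumn_decay
    {μ : ℝ} (hμ : 0 < μ) {δ₂ : ℝ} (hδ₂ : 0 ≤ δ₂)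
    (hδ₂w : 3 * ((eta F n K)⁻¹) ^ 2 * (Real.exp (μ * eta F n K) - 1) ^ 2 + a * ((25 / 8) * (c₁ * ((((F.P K).L : ℝ) ^ (F.P K).d) ^ (K - n))⁻¹ / c₀)) * (Real.exp (3 * μ) - 1) ^ 2 ≤ δ₂ ^ 2)
    (hwin₂ : Real.sqrt (max 2 (16 * c₀ * ((F.L : ℝ) ^ (K - n)) ^ 3 / (a * c₁))) * δ₂ ≤ 1 / 10)
    (y : Site (F.P K) (K - n)) (Y : Matrix (Fin 2) (Fin 2) ℂ) (x : Site (F.P K) 0) :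
    ‖WL2.equiv ℂ _ W₂ (G (T (ι (Pi.single y Y)))) (siteEquiv F K x)‖
      ≤ ((14 * (8 * Real.exp (3 * min μ (1 / 4)) *
              ((5 / 4) * Real.sqrt (2 * c₁) * ((((F.P K).L : ℝ) ^ (F.P K).d) ^ (K - n))⁻¹ / c₀ * Real.sqrt (2 * c₁)
                + Real.exp (3 * μ) * ((a * ((5 / 4) * Real.sqrt (2 * c₁) * ((((F.P K).L : ℝ) ^ (F.P K).d) ^ (K - n))⁻¹ / c₀) *
                    Real.sqrt ((25 / 8) * (c₁ * ((((F.P K).L : ℝ) ^ (F.P K).d) ^ (K - n))⁻¹ / c₀))) *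
                  ((8 * Real.sqrt (max 2 (16 * c₀ * ((F.L : ℝ) ^ (K - n)) ^ 3 / (a * c₁))) ^ 2) *
                    (Real.sqrt ((25 / 8) * (c₁ * ((((F.P K).L : ℝ) ^ (F.P K).d) ^ (K - n))⁻¹ / c₀)) * Real.sqrt (2 * c₁)))))))
          + (Real.sqrt (3 ^ 3 / (c₀ * ((F.L : ℝ) ^ (K - n)) ^ 3) * 8) *
              (Real.sqrt (8 * Real.exp (3 * min μ (1 / 4)) * Real.exp (6 * μ) * (2 * (1 + 1 / μ)) ^ 3) *
              ((8 * Real.sqrt (max 2 (16 * c₀ * ((F.L : ℝ) ^ (K - n)) ^ 3 / (a * c₁))) ^ 2) *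
                (Real.sqrt ((25 / 8) * (c₁ * ((((F.P K).L : ℝ) ^ (F.P K).d) ^ (K - n))⁻¹ / c₀)) * Real.sqrt (2 * c₁)))))) * Real.exp (-((min μ (1 / 4) / 2) * (Site.tdist (P := F.P K) (iterBlockOf (K - n) x) y : ℝ))) * ‖Y‖ := by
  have hc₀ : 0 < c₀ := Fact.out
  have hc₁ : 0 < c₁ := Fact.out
  have hLP := (F.P K).L_pos
  have h4 := norm_equiv_massiveColumn_apply_le_decay F h hε₀ hε7 U₀ hreg Q'' hseq ι hι T hT ha G hAG hμ hδ₂ hδ₂w hwin₂ y Y x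
  refine h4.trans (mul_le_mul_of_nonneg_right ?_ (norm_nonneg _))
  have hB₁ : 0 ≤ (14 * (8 * Real.exp (3 * min μ (1 / 4)) *
              ((5 / 4) * Real.sqrt (2 * c₁) * ((((F.P K).L : ℝ) ^ (F.P K).d) ^ (K - n))⁻¹ / c₀ * Real.sqrt (2 * c₁)
                + Real.exp (3 * μ) * ((a * ((5 / 4) * Real.sqrt (2 * c₁) * ((((F.P K).L : ℝ) ^ (F.P K).d) ^ (K - n))⁻¹ / c₀) *
                    Real.sqrt ((25 / 8) * (c₁ * ((((F.P K).L : ℝ) ^ (F.P K).d) ^ (K - n))⁻¹ / c₀))) *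
                  ((8 * Real.sqrt (max 2 (16 * c₀ * ((F.L : ℝ) ^ (K - n)) ^ 3 / (a * c₁))) ^ 2) *
                    (Real.sqrt ((25 / 8) * (c₁ * ((((F.P K).L : ℝ) ^ (F.P K).d) ^ (K - n))⁻¹ / c₀)) * Real.sqrt (2 * c₁))))))) := by positivity
  have hκ₀ : 0 ≤ min μ (1 / 4) := le_min hμ.le (by norm_num)
  have hd : 0 ≤ (Site.tdist (P := F.P K) (iterBlockOf (K - n) x) y : ℝ) := Nat.cast_nonneg _
  exact two_rate_le_one_rate hB₁ hκ₀ hd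

/-! ## §2 The pointwise value kernel of `P`, closed -/

include hε₀ hε7 hreg hseq hι hT ha hAG hGA in
set_option maxHeartbeats 400000 in
-- hb: the statement carries B2c's closed-form Gram constant and the chair's closed-form `B₁ + B₂` (README №24 class, as V5 §2∕§3).
/-- ★★★ **THE POINTWISE VALUE KERNEL OF `P = 1 − R_{Q″}(U₀)` FROM THE MEMBER LETTERS ONLY** (print's (3.49), VALUE half, `c₀∕c₁ = η³` at the pin): V5 ✓`norm_equiv_sub_projR_single_le` with
`hcol := hcol_of_massiveColumn_decay` (`κ := (min μ ¼)∕2`, `C_pt := B₁ + B₂`).  Hypotheses: `RegPr` + LOD letters + the column window at `μ` + B2c's window∕gap at the Gram slope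
`μ′ < (min μ ¼)∕2` + `‖ι(Q″·)‖ ≤ C_T‖·‖`, `‖G‖ ≤ C_G`, `m_B‖f‖ ≤ ‖G(Tf)‖`. [cite: Balaban1985BackgroundPropagators, Thm 3.1 (3.42) p.397, (3.49) p.399; Balaban1988RG2Cluster, (2.7) p.13] -/
theorem norm_equiv_sub_projR_single_le_closed
    {μ : ℝ} (hμ : 0 < μ) {δ₂ : ℝ} (hδ₂ : 0 ≤ δ₂)
    (hδ₂w : 3 * ((eta F n K)⁻¹) ^ 2 * (Real.exp (μ * eta F n K) - 1) ^ 2 + a * ((25 / 8) * (c₁ * ((((F.P K).L : ℝ) ^ (F.P K).d) ^ (K - n))⁻¹ / c₀)) * (Real.exp (3 * μ) - 1) ^ 2 ≤ δ₂ ^ 2)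
    (hwin₂ : Real.sqrt (max 2 (16 * c₀ * ((F.L : ℝ) ^ (K - n)) ^ 3 / (a * c₁))) * δ₂ ≤ 1 / 10)
    {μ' : ℝ} (hμ' : 0 ≤ μ') (hμ'κ : μ' < (min μ (1 / 4) / 2))
    {δ₁ : ℝ} (hδ₁ : 0 ≤ δ₁)
    (hδ : 3 * ((eta F n K)⁻¹) ^ 2 * (Real.exp (μ' * eta F n K) - 1) ^ 2 + a * ((25 / 8) * (c₁ * ((((F.P K).L : ℝ) ^ (F.P K).d) ^ (K - n))⁻¹ / c₀)) * (Real.exp (3 * μ') - 1) ^ 2 ≤ δ₁ ^ 2)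
    (hwin : Real.sqrt (max 2 (16 * c₀ * ((F.L : ℝ) ^ (K - n)) ^ 3 / (a * c₁))) * δ₁ ≤ 1 / 10)
    {CT : ℝ} (hCT : 0 ≤ CT) (hCTb : ∀ l : SiteL2K ℂ 3 (periodsT3 F K) c₀ W₂, ‖ι (Q'' l)‖ ≤ CT * ‖l‖)
    {CG : ℝ} (hCG : 0 ≤ CG) (hGn : ∀ f, ‖G f‖ ≤ CG * ‖f‖)
    {mB : ℝ} (hmB : 0 < mB) (hcoer : ∀ f : SiteL2K ℂ 3 (periodsT3 F n) c₁ W₂, mB * ‖f‖ ≤ ‖G (T f)‖)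
    (hgap : 3 * ((Real.sqrt (max 2 (16 * c₀ * ((F.L : ℝ) ^ (K - n)) ^ 3 / (a * c₁))) * (2 + Real.sqrt (max 2 (16 * c₀ * ((F.L : ℝ) ^ (K - n)) ^ 3 / (a * c₁)))))
          * (Real.sqrt 3 * (eta F n K)⁻¹ * (Real.exp (μ' * eta F n K) - 1) + (Real.sqrt 3 * (eta F n K)⁻¹ * (Real.exp (μ' * eta F n K) - 1)) ^ 2 + Real.sqrt a * CT * (Real.exp (3 * μ') - 1) + a * CT ^ 2 * (Real.exp (3 * μ') - 1) ^ 2)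
          * (8 * Real.sqrt (max 2 (16 * c₀ * ((F.L : ℝ) ^ (K - n)) ^ 3 / (a * c₁))) + 8 * Real.sqrt (max 2 (16 * c₀ * ((F.L : ℝ) ^ (K - n)) ^ 3 / (a * c₁))) ^ 2)
          * (CT * (1 + (Real.exp (3 * μ') - 1))) + CG * (CT * (Real.exp (3 * μ') - 1))) ^ 2 < mB ^ 2 / 2)
    (x x' : Site (F.P K) 0) (X' : Matrix (Fin 2) (Fin 2) ℂ) :
    ‖WL2.equiv ℂ _ W₂ (toL2S F K c₀ (Pi.single x' X') - projR (covLapSite F n K c₀ U₀) Q'' (toL2S F K c₀ (Pi.single x' X'))) (siteEquiv F K x)‖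
      ≤ (c₀ / c₁) * ((14 * (8 * Real.exp (3 * min μ (1 / 4)) *
              ((5 / 4) * Real.sqrt (2 * c₁) * ((((F.P K).L : ℝ) ^ (F.P K).d) ^ (K - n))⁻¹ / c₀ * Real.sqrt (2 * c₁)
                + Real.exp (3 * μ) * ((a * ((5 / 4) * Real.sqrt (2 * c₁) * ((((F.P K).L : ℝ) ^ (F.P K).d) ^ (K - n))⁻¹ / c₀) *
                    Real.sqrt ((25 / 8) * (c₁ * ((((F.P K).L : ℝ) ^ (F.P K).d) ^ (K - n))⁻¹ / c₀))) *
                  ((8 * Real.sqrt (max 2 (16 * c₀ * ((F.L : ℝ) ^ (K - n)) ^ 3 / (a * c₁))) ^ 2) *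
                    (Real.sqrt ((25 / 8) * (c₁ * ((((F.P K).L : ℝ) ^ (F.P K).d) ^ (K - n))⁻¹ / c₀)) * Real.sqrt (2 * c₁)))))))
          + (Real.sqrt (3 ^ 3 / (c₀ * ((F.L : ℝ) ^ (K - n)) ^ 3) * 8) *
              (Real.sqrt (8 * Real.exp (3 * min μ (1 / 4)) * Real.exp (6 * μ) * (2 * (1 + 1 / μ)) ^ 3) *
              ((8 * Real.sqrt (max 2 (16 * c₀ * ((F.L : ℝ) ^ (K - n)) ^ 3 / (a * c₁))) ^ 2) *
                (Real.sqrt ((25 / 8) * (c₁ * ((((F.P K).L : ℝ) ^ (F.P K).d) ^ (K - n))⁻¹ / c₀)) * Real.sqrt (2 * c₁)))))) ^ 2 * ((mB ^ 2 / 2 - 3 * ((Real.sqrt (max 2 (16 * c₀ * ((F.L : ℝ) ^ (K - n)) ^ 3 / (a * c₁))) * (2 + Real.sqrt (max 2 (16 * c₀ * ((F.L : ℝ) ^ (K - n)) ^ 3 / (a * c₁)))))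
          * (Real.sqrt 3 * (eta F n K)⁻¹ * (Real.exp (μ' * eta F n K) - 1) + (Real.sqrt 3 * (eta F n K)⁻¹ * (Real.exp (μ' * eta F n K) - 1)) ^ 2 + Real.sqrt a * CT * (Real.exp (3 * μ') - 1) + a * CT ^ 2 * (Real.exp (3 * μ') - 1) ^ 2)
          * (8 * Real.sqrt (max 2 (16 * c₀ * ((F.L : ℝ) ^ (K - n)) ^ 3 / (a * c₁))) + 8 * Real.sqrt (max 2 (16 * c₀ * ((F.L : ℝ) ^ (K - n)) ^ 3 / (a * c₁))) ^ 2)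
          * (CT * (1 + (Real.exp (3 * μ') - 1))) + CG * (CT * (Real.exp (3 * μ') - 1))) ^ 2)⁻¹ * Real.exp (9 * μ'))
        * (4 * (2 * (1 + 1 / ((min μ (1 / 4) / 2) - μ'))) ^ 3) ^ 2
        * Real.exp (-(μ' * (Site.tdist (P := F.P K) (iterBlockOf (K - n) x) (iterBlockOf (K - n) x') : ℝ))) * ‖(frobEquiv.symm X' : W₂)‖ := by
  have hc₀ : 0 < c₀ := Fact.out
  have hc₁ : 0 < c₁ := Fact.out
  have hLP := (F.P K).L_pos
  have hCpt : 0 ≤ ((14 * (8 * Real.exp (3 * min μ (1 / 4)) *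
              ((5 / 4) * Real.sqrt (2 * c₁) * ((((F.P K).L : ℝ) ^ (F.P K).d) ^ (K - n))⁻¹ / c₀ * Real.sqrt (2 * c₁)
                + Real.exp (3 * μ) * ((a * ((5 / 4) * Real.sqrt (2 * c₁) * ((((F.P K).L : ℝ) ^ (F.P K).d) ^ (K - n))⁻¹ / c₀) *
                    Real.sqrt ((25 / 8) * (c₁ * ((((F.P K).L : ℝ) ^ (F.P K).d) ^ (K - n))⁻¹ / c₀))) *
                  ((8 * Real.sqrt (max 2 (16 * c₀ * ((F.L : ℝ) ^ (K - n)) ^ 3 / (a * c₁))) ^ 2) *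
                    (Real.sqrt ((25 / 8) * (c₁ * ((((F.P K).L : ℝ) ^ (F.P K).d) ^ (K - n))⁻¹ / c₀)) * Real.sqrt (2 * c₁)))))))
          + (Real.sqrt (3 ^ 3 / (c₀ * ((F.L : ℝ) ^ (K - n)) ^ 3) * 8) *
              (Real.sqrt (8 * Real.exp (3 * min μ (1 / 4)) * Real.exp (6 * μ) * (2 * (1 + 1 / μ)) ^ 3) *
              ((8 * Real.sqrt (max 2 (16 * c₀ * ((F.L : ℝ) ^ (K - n)) ^ 3 / (a * c₁))) ^ 2) *
                (Real.sqrt ((25 / 8) * (c₁ * ((((F.P K).L : ℝ) ^ (F.P K).d) ^ (K - n))⁻¹ / c₀)) * Real.sqrt (2 * c₁)))))) := by positivity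
  exact norm_equiv_sub_projR_single_le F h hε₀ hε7 U₀ hreg Q'' hseq ι hι T hT ha G hAG hGA hμ' hμ'κ hδ₁ hδ hwin hCT hCTb hCG hGn hmB hcoer hgap hCpt
    (hcol_of_massiveColumn_decay F h hε₀ hε7 U₀ hreg Q'' hseq ι hι T hT ha G hAG hμ hδ₂ hδ₂w hwin₂) x x' X'

end Summit.QuantumFields.YangMills.Theorems.Prop7ComplementaryProjectorPointwiseDecayClosed

end
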